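import Literature.MathematicalPhysics.QuantumFieldTheory.Dimock2011to13.BlockAveragingComposition
import Literature.MathematicalPhysics.QuantumFieldTheory.Dimock2011to13.ConstantFieldSplit
import Literature.MathematicalPhysics.QuantumFieldTheory.Dimock2011to13.CharacteristicFunctionSplit

/-!
# Dimock, *The renormalization group according to Balaban* II, §3.11.2 `\subsubsection{redundant characteristic
# functions}` — LEMMA 3.11 (the bracketed characteristic functions do not depend on `W_k` in `Λ_{k+1}`) and LEMMA 3.13
# `\label{vanishing}` (`χ_k(Λ**_{k+1}) χ^q_k(Λ**_{k+1}) = 1`), ASSEMBLED from their printed inputs on the tree's `ℤ^d`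
# block geometry: the algebra of the scaled small-field classes `c𝒮_k(□)`, the fluctuation half, the background half
# ((not) → (not4) → (not5) → (snappy) → `¼𝒮_k(□)` → `½𝒮_k(□)`), and the `χ^q` half via (ding2)

**Citation header (reproduction of PUBLISHED work; template of the Bałaban lattice Yang–Mills cell).**
J. Dimock, *The renormalization group according to Balaban II. Large fields*, J. Math. Phys. **54** (2013) 092301
(= arXiv:1212.5562v2) [Dimock2013BalabanII], §3.11 `\subsection{more estimates}` (TeX L3711), §3.11.2
`\subsubsection{redundant characteristic functions}` L3921–4163: (pinky1) L3923–3927, (slumber) L3931–3935, LEMMA 3.11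
(the eleventh `\begin{lem}` of §3, unlabelled; L3940–3945, proof L3949–3958), LEMMA 3.12 `\label{replace}` ((note7), (note6); L3963–3981,
proof L3984–4060), LEMMA 3.13 `\label{vanishing}` L4065–4071 with its proof L4074–4163: the fluctuation half L4080–4093
((summers) L4083–4086), the background half L4105–4150 ((not4) L4110–4116, (ding3) L4119–4123, (not5) L4128–4134, (snappy)
L4138–4144), the `χ^q` half L4155–4163; and the inputs it quotes: §3.2 DEFINITION `\label{s}` (yass1) L2063–2073 and LEMMA 3.1
(2.) L2110–2116, §3.10 (not) L3610–3617 (*"Call functions satisfying (not) 𝒮⁰_{k+1}(□), since when we scale later on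
these will become the inequalities defining 𝒮_{k+1}(□)"* L3619–3622), §3.7 (ding2)∕(ding3) and (salt).  TeX line numbers
refer to the arXiv source held by the cell (`inputs/files/dimock/src/1212.5562/1212.5562.tex`, sha16 75c5792fc48eacbc);
every quotation below was read there this session.  Dimock's papers are published and refereed and are the cell's
TEMPLATE, not manuscripts under audit; no quantity of the Bałaban series is touched.

**What the paper prints (verbatim, TeX → Unicode).**  L3938–3940: *"We want to show that the last two characteristic
functions in (pinky1) are redundant. But first we show that the remaining terms in the bracket have no dependence on W_k
in Λ_{k+1}"*.  LEMMA 3.11 (L3940–3945): *"χ_k(Λ_k − Λ**_{k+1}) χ^q_k(Ω_{k+1} − Λ**_{k+1}) does not depend on W_k in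
Λ_{k+1}."*; proof (L3949–3958): *"The Green's function G_{k,Ω′,r}(□*) only connects points in □*, … It follows that
(C^{1/2}_{k,Ω′})^{loc}f on a set X only depends on f in X*.  Now χ^q_k(Ω_{k+1} − Λ**_{k+1}) depends on (C^{1/2}_{k,Ω′})^{loc}W_k
in (Λ**_{k+1})^c and so on W_k in ((Λ**_{k+1})^c)* ⊂ (Λ*_{k+1})^c ⊂ Λ^c_{k+1}.  The function χ_k(Λ_k − Λ**_{k+1}) also depends
on (C^{1/2}_{k,Ω′})^{loc}W_k in (Λ**_{k+1})^c, but also on φ_{k,Ω(□)}((C^{1/2}_{k,Ω′})^{loc}W_k) on □̃ for □ ⊂ Λ_k − Λ**_{k+1}. By a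
similar argument this depends on W_k on ((Λ**_{k+1})^c)** ⊂ Λ^c_{k+1}."*  LEMMA 3.13 (L4065–4071): *"The bracketed
characteristic functions in (pinky1) enforce  χ_k(Λ**_{k+1}) χ^q_k(Λ**_{k+1}) = 1"*.  Proof, L4074–4078: *"To show
χ_k(Λ**_{k+1}) = 1 we must show that Ψ^{loc}_{k,Ω_{k+1}}(Ω′) + (C^{1/2}_{k,Ω′})^{loc}W_k ∈ 𝒮_k(□) for any M-cube □ ⊂ Λ**_{k+1}. We
argue separately that (C^{1/2}_{k,Ω′})^{loc}W_k ∈ ½𝒮_k(□) and that Ψ^{loc}_{k,Ω_{k+1}}(Ω′) ∈ ½𝒮_k(□)."*  L4080–4093: *"For the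
(C^{1/2}_{k,Ω′})^{loc}W_k bounds start with the fact that |W_k| ≤ p_{0,k} on Λ^{4*}_k. … we have on Λ^{3*}_k by (around)
|(C^{1/2}_{k,Ω′})^{loc}W_k| ≤ Cp_{0,k}   |∂(C^{1/2}_{k,Ω′})^{loc}W_k| ≤ Cp_{0,k}  (summers) … Then (Cp_{0,k})^{−1}p_k(C^{1/2}_{k,Ω′})^{loc}W_k
satisfies the same bounds with only a p_k on the right side. By lemma 3.1 for □ ⊂ Λ**_k we have
(Cp_{0,k})^{−1}p_k(C^{1/2}_{k,Ω′})^{loc}W_k ∈ C𝒮_k(□) or (C^{1/2}_{k,Ω′})^{loc}W_k ∈ Cp_{0,k}p_k^{−1}𝒮_k(□̃). But for p_0 < p and λ_k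
sufficiently small Cp_{0,k}p_k^{−1} = C(−log λ_k)^{p_0−p} < ½ so we have the result."*  L4105–4116: *"for an LM cube □ ⊂
Λ^{4*}_{k+1}, Φ_{k+1} satisfies the bounds (not) on □̃. For M sufficiently large CM^{−1/2}p_{k+1} is smaller than anything on the
right side of these equations. Thus by (note7) we may replace φ⁰_{k+1,Ω(□)} by φ⁰_{k+1,Ω′}. Then for □ ⊂ Λ^{4*}_{k+1} on □̃:
|Φ_{k+1} − Q_{k+1}φ⁰_{k+1,Ω′}| ≤ 2p_{k+1}L^{−1/2}  |∂φ⁰_{k+1,Ω′}| ≤ 2p_{k+1}L^{−3/2}  |φ⁰_{k+1,Ω′}| ≤ 2p_{k+1}α_{k+1}^{−1}L^{−1/2}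
(not4)"*; L4119–4134: *"Next recall that  Ψ_{k,Ω_{k+1}}(Ω′) = Q_kφ⁰_{k+1,Ω′} + (aL^{−2}/(a_k + aL^{−2})) Q^T(Φ_{k+1} −
Q_{k+1}φ⁰_{k+1,Ω′})  (ding3)  This lets us replace Φ_{k+1} − Q_{k+1}φ⁰_{k+1,Ω′} by Ψ_{k,Ω_{k+1}}(Ω′) − Q_kφ⁰_{k+1,Ω′} in the above
inequality … (not5)"*; L4135–4150: *"Now for □ ⊂ Λ**_{k+1} (note6) lets us replace φ_{k,Ω(Λ*_k)}(Ψ̂_{k,Ω′}) by φ^{min}_{k,Ω(□)} …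
for M sufficiently large, and so on □̃  |Ψ − Q_kφ^{min}| ≤ 3p_{k+1}L^{−1/2}  |∂φ^{min}| ≤ 3p_{k+1}L^{−3/2}  |φ^{min}| ≤
3p_{k+1}α_{k+1}^{−1}L^{−1/2}  (snappy)  Since α_{k+1}^{−1} ≤ L^{−1/4}α_k^{−1} and p_{k+1} ≤ (1 + log L)^p p_k this says that
Ψ_{k,Ω_{k+1}}(Ω′) ∈ ¼𝒮_k(□) for L sufficiently large. But |Ψ^{loc}_{k,Ω_{k+1}}(Ω′) − Ψ_{k,Ω_{k+1}}(Ω′)| ≤ e^{−r_{k+1}} from (salt).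
Hence Ψ^{loc}_{k,Ω_{k+1}}(Ω′) ∈ ½𝒮_k(□). This completes the proof that χ_k(Λ**_{k+1}) = 1."*  L4155–4163: *"Now we show
χ^q_k(Λ**_{k+1}) = 1, that is we show that on □ ⊂ Λ**_{k+1}  |Φ_{k+1} − Q(Ψ^{loc}_{k,Ω_{k+1}}(Ω′) + (C^{1/2}_{k,Ω})^{loc}W)| ≤ p_k  By
(salt) and (summers) this reduces to showing that |Φ_{k+1} − QΨ_{k,Ω_{k+1}}(Ω′)| ≤ ½p_k. This follows by (ding2) and then
(not4):  |Φ_{k+1} − QΨ_{k,Ω_{k+1}}(Ω′)| ≤ |Φ_{k+1} − Q_{k+1}φ⁰_{k+1,Ω′}| ≤ 2p_{k+1}L^{−1/2} ≤ ½p_k"*.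

**Why this module.**  TEMPLATE.md §4.2 row «D2 §3.10 new characteristic functions» records as Dimock-side content that
*"§3.11.2 'redundant characteristic functions', §3.11.3 … spell out what B14 leaves implicit"* (B14 p. 245: *"Many new
characteristic functions appear in connection with large field regions, and they play an important, although quite
technical, role"*), and lists §3.11.2 (LEMMAS 3.11–3.13) among the items with NO kernel object (the row's §3.11 entry so
far is LEMMA 3.10 `singsong1`, `FluctuationFieldBound` v8.94).  The redundancy lemma is pure bookkeeping over the
small-field classes of DEFINITION 3.s — which the tree HAS as the predicate `SmallFieldBounds.LocalSmallField` — once its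
analytic inputs ((summers) = (around), LEMMA 3.1 (2.), LEMMA 3.12 (note6)∕(note7), (salt)) are taken as hypotheses, and
that bookkeeping is what is proved here, line by line, with every «sufficiently small ∕ large» an explicit inequality.

**What is reproduced here (kernel-checked, zero `sorry`).**  Carrier: the tree's `ℤ^d` block geometry
(`Balaban1983to89.B6QGQLower276`: `X d`, `blk`, `B n y`, `U n S`; `SmallFieldBounds.qavg`∕`fdFine`∕`fdUnit`;
`BlockAveragingComposition.blk_blk`∕`qavg_comp` for the two-level structure unit cubes ⊂ `L`-cubes) and the tree's
DEFINITION 3.s predicate `LocalSmallField n q α S₀ S Φ φ` (the three bounds (yass1) with `p_k ↦ q`, so that `Φ ∈ c𝒮_k(□)`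
IS `LocalSmallField n (c·p_k) α …`).
* Part 1 — THE ALGEBRA OF THE SCALED CLASSES (the steps *"∈ ½𝒮_k(□) … ∈ ½𝒮_k(□) ⟹ ∈ 𝒮_k(□)"* L4076–4078, *"∈ C p_{0,k}p_k^{−1}
  𝒮_k"* L4090–4091, *"∈ ¼𝒮_k … Hence ∈ ½𝒮_k"* L4146–4150): linearity `qavg_add`∕`qavg_sub`∕`qavg_smul`,
  `fdFine_add`∕`fdFine_sub`∕`fdFine_smul`; **`sf_add`** (`𝒮(q₁) + 𝒮(q₂) ⊆ 𝒮(q₁ + q₂)` for pairs), `sf_mono` (`q ≤ q′`), `sf_mono₂`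
  (`q ≤ q′`, `qα⁻¹ ≤ q′α′⁻¹`: change of level `k+1 → k`), `sf_smul` (`c·𝒮(q) ⊆ 𝒮(|c|q)`), **`of_fine_sup`** (a fine field `δ` with
  `|δ|, |∂δ| ≤ ε` is in `𝒮(ε)` paired with the unit field `0`), **`fine_replacement`** (`(Φ, φ) ∈ 𝒮(q)`, `|φ′ − φ|, |∂(φ′ − φ)| ≤
  ε ⟹ (Φ, φ′) ∈ 𝒮(q + ε)` — the mechanism of *"we may replace φ⁰_{k+1,Ω(□)} by φ⁰_{k+1,Ω′}"* L4108 and of (note6) L4135),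
  **`unit_perturbation`** (`(Ψ, bg Ψ) ∈ 𝒮(q)`, `|Ψ′ − Ψ| ≤ t`, `bg` additive with `|bg δ|, |∂ bg δ| ≤ K t` ⟹ `(Ψ′, bg Ψ′) ∈ 𝒮(q
  + (1+K)t)` — the mechanism of *"But |Ψ^{loc} − Ψ| ≤ e^{−r_{k+1}} … Hence Ψ^{loc} ∈ ½𝒮_k(□)"* L4148–4150).
* Part 2 — THE FLUCTUATION HALF (L4080–4093): **`fluctuation_half`** — from (summers) (`|W̃|, |∂W̃| ≤ C₂p_{0,k}` on the unit
  points `Sbig ⊇` the sets of `□`), LEMMA 3.1 (2.) as the hypothesis shape `converse` (bounds `|Φ| ≤ qα⁻¹`, `|∂Φ| ≤ q` on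
  `Sbig` ⟹ `(Φ, bg Φ) ∈ C₁𝒮(q)`, homogeneous in `q`), `0 < α ≤ 1` and the smallness `C₁C₂p_{0,k} ≤ ½p_k` ⟹ `(W̃, bg W̃) ∈
  ½𝒮_k(□)`; and the smallness MADE EXPLICIT, **`log_powers_half`**: for `p₀ < p`, `C > 0` and `ℓ = −log λ_k ≥ (2C)^{1/(p−p₀)}`,
  `C·ℓ^{p₀} ≤ ½ℓ^p` (*"for p_0 < p and λ_k sufficiently small Cp_{0,k}p_k^{−1} = C(−log λ_k)^{p_0−p} < ½"*).
* Part 3 — THE BACKGROUND HALF (L4105–4150) on the TWO-LEVEL carrier (`L = m+1` unit points per `L`-block side, `n′+1 =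
  L^k` fine sites per unit side, `n+1 = (m+1)(n′+1)` per `L`-block side; `U_comp`: `U n T = U n′ (U m T)`;
  `fdFine_two_level`: `∂` in `L`-block units is `(m+1)·∂` in unit units): (not) IS `LocalSmallField n (p_{k+1}L^{−1/2}) α_{k+1}
  T₀ T Φ_{k+1} φ⁰_□` (reading (i)); **`not4`** (= `fine_replacement` + `sf_mono`: (not) ∧ (note7)-bounds `≤ ε ≤ p_{k+1}L^{−1/2}` ⟹
  `(Φ_{k+1}, φ⁰_{Ω′}) ∈ 𝒮_{L-blocks}(2p_{k+1}L^{−1/2})`); **`psiOf`** (= (ding3): `Ψ(y) = (Q_kφ)(y) + c·(Φ_{k+1} − Q_{k+1}φ)(blk_L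
  y)`, `c = aL^{−2}/(a_k + aL^{−2})`) with `psiOf_sub_qavg`, and **`not5`** (`0 ≤ c ≤ 1`: `(Φ_{k+1}, φ) ∈ 𝒮_{L-blocks, n}(q)` ⟹
  `(Ψ, φ) ∈ 𝒮_{units, n′}(q)` on the unit points of the same blocks — *"This lets us replace Φ_{k+1} − Q_{k+1}φ⁰ by Ψ −
  Q_kφ⁰"*); **`snappy`** (= `fine_replacement` again with (note6)-bounds: `𝒮(2q) → 𝒮(3q)`); the level change
  **`inv_alpha_succ_le`** (`α_{k+1}^{−1} ≤ L^{−1/4}α_k^{−1}` for `α = ConstantFieldSplit.alpha`, `λ_{k+1} = Lλ_k`, `μ̄_{k+1} =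
  L²μ̄_k`, `L ≥ 1`), **`quarter_arith`** (`p_{k+1} ≤ Gp_k`, `α_{k+1}^{−1} ≤ τα_k^{−1}` with `τ ≤ 1`, `12·G·s ≤ 1` ⟹ `3p_{k+1}s ≤
  ¼p_k` and `3p_{k+1}s·α_{k+1}^{−1} ≤ ¼p_k·α_k^{−1}`; `s = L^{−1/2}`, `G = (1 + log L)^p`, `τ = L^{−1/4}` — *"for L sufficiently
  large"* = `12(1 + log L)^p ≤ L^{1/2}`, `quarter_arith_L`), **`quarter`** ((snappy) ⟹ `(Ψ, φ^{min}) ∈ ¼𝒮_k(□)` by `sf_mono₂`),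
  **`half_of_quarter`** (`unit_perturbation` with `t = e^{−r_{k+1}}`, `(1+K)e^{−r_{k+1}} ≤ ¼p_k` ⟹ `(Ψ^{loc}, bg Ψ^{loc}) ∈
  ½𝒮_k(□)`), and the lemma's first conclusion **`chi_eq_one`** (the two halves and `bg` additive ⟹ `(Ψ^{loc} + W̃, bg(Ψ^{loc}
  + W̃)) ∈ 𝒮_k(□)`, i.e. `χ_k(□) = 1`).
* Part 4 — THE `χ^q` HALF (L4155–4163): `qavg_blockConst`, **`qavg_psiOf`** and **`ding2`** (averaging (ding3) over an
  `L`-block: `Φ_{k+1} − QΨ = (1 − c)(Φ_{k+1} − Q_{k+1}φ)`, and `1 − c = a_k/(a_k + aL^{−2})` `sub_coeff`), **`chi_q_half`**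
  (`|Φ_{k+1} − QΨ| ≤ 2q ≤ ½p_k` from (not4)'s first clause and `0 ≤ c ≤ 1`), **`chi_q_eq_one`** (`|Φ_{k+1} − Q(Ψ^{loc} + W̃)| ≤
  p_k` from `|Φ_{k+1} − QΨ| ≤ ½p_k`, `|Ψ^{loc} − Ψ| ≤ t` on the block, `|W̃| ≤ w` on the block and `t + w ≤ ½p_k` — *"By (salt)
  and (summers) this reduces to showing |Φ_{k+1} − QΨ| ≤ ½p_k"*).
* Part 5 — LEMMA 3.11 (support bookkeeping, generic site type `C` with the tree's enlargement `CharacteristicFunctionSplit.enl`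
  for `X ↦ X*` and Mathlib's `DependsOn`): `enl_mono`, **`enl_compl_enl_subset`** (`((X*)^c)* ⊆ X^c` for a symmetric
  distance), `dependsOn_comp_local` (a functional of `(T f)|_A` with `T` local through `*` depends on `f|_{A*}` only),
  **`lemma311_q`** (`χ^q` depends on `W` only off `Λ`: `A = (Λ**)^c`, one local operator), **`lemma311_chi`** (two local
  operators: `((Λ**)^c)** ⊆ Λ^c`).

**Readings ∕ divergences (declared).**  (i) (not) L3610–3617 is read on the `L`-block carrier with the fine derivative
in `L`-block units: `|∂φ⁰| ≤ p_{k+1}L^{−3/2}` in `η_k`-units is `|fdFine n φ⁰| ≤ p_{k+1}L^{−1/2}` with `n + 1 = L^{k+1}`, so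
that (not) is EXACTLY `LocalSmallField n (p_{k+1}L^{−1/2}) α_{k+1}` (all three clauses with the one bound `q =
p_{k+1}L^{−1/2}`, as the print's *"these will become the inequalities defining 𝒮_{k+1}(□)"* says); consequently (not4),
(not5), (snappy) are `LocalSmallField … (2q)`, `(2q)`, `(3q)` and their printed second clauses (`2p_{k+1}L^{−3/2}`,
`3p_{k+1}L^{−3/2}`, sharper by `L^{−1}` in unit units, `fdFine_two_level`) are carried by the predicate only in the weaker
form `≤ 2q`, `≤ 3q` — which is all that the conclusion `Ψ ∈ ¼𝒮_k(□)` uses.  (ii) The analytic inputs are hypotheses with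
the printed shapes: (summers) (`hW`, `hdW`), LEMMA 3.1 (2.) (`converse`; its proof *"[Bal82b], [Bal95]"* needs the
random-walk bounds and is not in the tree — `SmallFieldBounds` has part (1.) only), (note7)∕(note6) (`hδ`, `hdδ`: sup
bounds `ε` on the difference of the two fine fields and of their derivatives, with *"M sufficiently large"* = `ε ≤ q`),
(salt) (`|Ψ^{loc} − Ψ| ≤ t`), and — made visible by the typing, used tacitly at L4148–4150 — the sup-norm regularity of
the LINEAR background map `bg = Ψ ↦ φ_{k,Ω(□)}(Q̃^T Ψ)` (`|bg δ|, |∂ bg δ| ≤ K‖δ‖_∞`, LEMMA 2.7 (twoone) shape) with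
additivity `bg(Ψ + δ) = bg Ψ + bg δ`.  (iii) `p_k = (−log λ_k)^p` with real exponents `p₀ < p` (the print: integers);
`α_k = ConstantFieldSplit.alpha μ̄_k λ_k = max(μ̄_k^{1/2}, λ_k^{1/4})` (tree def, gen 36).  (iv) The sets: `S₀ ⊆ S` (print `□̃ ∩
Ω_k ⊆ □̃`), `Sbig` (print `Λ^{3*}_k ⊇ □^{∼(2R+1)}`), `T₀ ⊆ T` (`L`-block labels); the buffers `*`, `**`, `4*`, `∼` are not
instantiated beyond Part 5's `enl`.  (v) Part 5 reads *"depends on f in X*"* as Mathlib's `DependsOn` through the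
tree's `enl d r` (any symmetric `ℕ`-valued distance on a finite site type).

**What is NOT claimed.**  LEMMA 3.12 `\label{replace}` ((note6)∕(note7): the random-walk cancellation *"they have the
same leading term which cancels"* L4029–4031), (summers) = (around), LEMMA 3.1 (2.), (salt), (slumber), the construction
of `Ψ^{loc}`, `(C^{1/2})^{loc}`, `φ_{k,Ω(□)}`; §3.11.3 LEMMA 3.14 `technical`; anything of B1–B16 (TEMPLATE.md §4.2 row «D2
§3.10» ↔ B14 §3 characteristic functions — the row's Bałaban side untouched, grade T unchanged).  NOT summit progress;
NOT a statement about any Bałaban paper; NOT continuum; NOT Clay.  NEW leaf; imports this lineage's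
`BlockAveragingComposition` (⟶ `SmallFieldBounds`, the carrier), `ConstantFieldSplit` (`alpha`), `CharacteristicFunctionSplit`
(`enl`); no Summits import; no cycle; modifies nothing; no named fact (net debt 0).  Unit `b2b-balaban-template` gen 38 round 2
(journal CLAIM D2-REDUNDANT-CHARFUN-KERNEL); cell records TEMPLATE.md §4.2 row «D2 §3.10 new characteristic functions» (§3.11
items), §15.2; GAPS C-tmpl38-2.
-/

noncomputable section

open Finset
open Literature.MathematicalPhysics.QuantumFieldTheory.Balaban1983to89.B6QGQLower276
open Literature.MathematicalPhysics.QuantumFieldTheory.Dimock2011to13.SmallFieldBounds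
open Literature.MathematicalPhysics.QuantumFieldTheory.Dimock2011to13.BlockAveragingComposition (blk_blk qavg_comp B_comp)
open Literature.MathematicalPhysics.QuantumFieldTheory.Dimock2011to13.ConstantFieldSplit (alpha alpha_pos)

namespace Literature.MathematicalPhysics.QuantumFieldTheory.Dimock2011to13.RedundantCharacteristicFunctions

variable {d : ℕ}

/-! ## Part 1. Linearity of `Q_k`, `∂`; the algebra of the scaled classes `c𝒮_k(□)` -/

/-- `Q` is additive. [cite: Dimock2013BalabanII, §3.11.2 Lemma 3.13 proof L4076–4078 (arXiv:1212.5562v2 TeX)] -/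
theorem qavg_add (n : ℕ) (f g : X d → ℝ) (y : X d) : qavg n (f + g) y = qavg n f y + qavg n g y := by
  simp only [qavg_def, Pi.add_apply, Finset.sum_add_distrib, mul_add]

/-- `Q` respects differences. [cite: Dimock2013BalabanII, §3.11.2 Lemma 3.13 proof L4105–4116 (arXiv:1212.5562v2 TeX)] -/
theorem qavg_sub (n : ℕ) (f g : X d → ℝ) (y : X d) : qavg n (f - g) y = qavg n f y - qavg n g y := by
  simp only [qavg_def, Pi.sub_apply, Finset.sum_sub_distrib, mul_sub]

/-- `Q` is homogeneous. [cite: Dimock2013BalabanII, §3.11.2 Lemma 3.13 proof L4088–4091 (arXiv:1212.5562v2 TeX)] -/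
theorem qavg_smul (n : ℕ) (c : ℝ) (f : X d → ℝ) (y : X d) : qavg n (c • f) y = c * qavg n f y := by
  rw [qavg_def, qavg_def]
  simp only [Pi.smul_apply, smul_eq_mul]
  rw [← Finset.mul_sum]
  ring

/-- `∂` is additive. [cite: Dimock2013BalabanII, §3.11.2 Lemma 3.13 proof L4076–4078 (arXiv:1212.5562v2 TeX)] -/
theorem fdFine_add (n : ℕ) (μ : Fin d) (f g : X d → ℝ) (x : X d) :
    fdFine n μ (f + g) x = fdFine n μ f x + fdFine n μ g x := by
  simp only [fdFine, Pi.add_apply]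
  ring

/-- `∂` respects differences. [cite: Dimock2013BalabanII, §3.11.2 Lemma 3.13 proof L4105–4116 (arXiv:1212.5562v2 TeX)] -/
theorem fdFine_sub (n : ℕ) (μ : Fin d) (f g : X d → ℝ) (x : X d) :
    fdFine n μ (f - g) x = fdFine n μ f x - fdFine n μ g x := by
  simp only [fdFine, Pi.sub_apply]
  ring

/-- `∂` is homogeneous. [cite: Dimock2013BalabanII, §3.11.2 Lemma 3.13 proof L4088–4091 (arXiv:1212.5562v2 TeX)] -/
theorem fdFine_smul (n : ℕ) (μ : Fin d) (c : ℝ) (f : X d → ℝ) (x : X d) :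
    fdFine n μ (c • f) x = c * fdFine n μ f x := by
  simp only [fdFine, Pi.smul_apply, smul_eq_mul]
  ring

section Classes

variable {n : ℕ} {q q₁ q₂ q' α α' : ℝ} {S₀ S : Finset (X d)} {Φ Φ₁ Φ₂ φ φ₁ φ₂ : X d → ℝ}

/-- **`c₁𝒮_k(□) + c₂𝒮_k(□) ⊆ (c₁ + c₂)𝒮_k(□)`** for pairs (unit field, fine field): the three bounds (yass1) are seminorm
bounds, so they add (the step *"(C^{1/2})^{loc}W_k ∈ ½𝒮_k(□) and Ψ^{loc} ∈ ½𝒮_k(□)"* ⟹ the sum is in `𝒮_k(□)`).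
[cite: Dimock2013BalabanII, §3.11.2 Lemma 3.13 proof L4074–4078 (arXiv:1212.5562v2 TeX)] -/
theorem sf_add (h₁ : LocalSmallField n q₁ α S₀ S Φ₁ φ₁) (h₂ : LocalSmallField n q₂ α S₀ S Φ₂ φ₂) :
    LocalSmallField n (q₁ + q₂) α S₀ S (Φ₁ + Φ₂) (φ₁ + φ₂) := by
  refine ⟨fun y hy => ?_, fun μ x hx hxe => ?_, fun x hx => ?_⟩
  · have e1 : (Φ₁ + Φ₂) y - qavg n (φ₁ + φ₂) y = (Φ₁ y - qavg n φ₁ y) + (Φ₂ y - qavg n φ₂ y) := by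
      rw [Pi.add_apply, qavg_add]; ring
    rw [e1]
    exact (abs_add_le _ _).trans (add_le_add (h₁.1 y hy) (h₂.1 y hy))
  · rw [fdFine_add]
    exact (abs_add_le _ _).trans (add_le_add (h₁.2.1 μ x hx hxe) (h₂.2.1 μ x hx hxe))
  · rw [Pi.add_apply, add_mul]
    exact (abs_add_le _ _).trans (add_le_add (h₁.2.2 x hx) (h₂.2.2 x hx))

/-- `c𝒮_k(□) ⊆ c′𝒮_k(□)` for `c ≤ c′` (`α_k ≥ 0`). [cite: Dimock2013BalabanII, §3.11.2 Lemma 3.13 proof L4090–4093 (arXiv:1212.5562v2 TeX)] -/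
theorem sf_mono (hα : 0 ≤ α) (h : LocalSmallField n q α S₀ S Φ φ) (hq : q ≤ q') : LocalSmallField n q' α S₀ S Φ φ :=
  ⟨fun y hy => (h.1 y hy).trans hq, fun μ x hx hxe => (h.2.1 μ x hx hxe).trans hq,
    fun x hx => (h.2.2 x hx).trans (mul_le_mul_of_nonneg_right hq (inv_nonneg.2 hα))⟩

/-- CHANGE OF LEVEL: the class with parameters `(q, α)` is contained in the class with `(q′, α′)` as soon as `q ≤ q′` and
`qα⁻¹ ≤ q′α′⁻¹` (the step from (snappy), level `k+1` parameters `p_{k+1}`, `α_{k+1}`, to `¼𝒮_k(□)`, parameters `p_k`, `α_k`).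
[cite: Dimock2013BalabanII, §3.11.2 Lemma 3.13 proof L4144–4147 (arXiv:1212.5562v2 TeX)] -/
theorem sf_mono₂ (h : LocalSmallField n q α S₀ S Φ φ) (hq : q ≤ q') (hqα : q * α⁻¹ ≤ q' * α'⁻¹) :
    LocalSmallField n q' α' S₀ S Φ φ :=
  ⟨fun y hy => (h.1 y hy).trans hq, fun μ x hx hxe => (h.2.1 μ x hx hxe).trans hq,
    fun x hx => (h.2.2 x hx).trans hqα⟩

/-- `c·(pair in 𝒮(q))` is in `𝒮(|c|q)` (the step *"(Cp_{0,k})^{−1}p_k(C^{1/2})^{loc}W_k satisfies the same bounds with only a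
p_k on the right side"*). [cite: Dimock2013BalabanII, §3.11.2 Lemma 3.13 proof L4088–4091 (arXiv:1212.5562v2 TeX)] -/
theorem sf_smul (h : LocalSmallField n q α S₀ S Φ φ) (c : ℝ) :
    LocalSmallField n (|c| * q) α S₀ S (c • Φ) (c • φ) := by
  refine ⟨fun y hy => ?_, fun μ x hx hxe => ?_, fun x hx => ?_⟩
  · rw [Pi.smul_apply, smul_eq_mul, qavg_smul, ← mul_sub, abs_mul]
    exact mul_le_mul_of_nonneg_left (h.1 y hy) (abs_nonneg c)
  · rw [fdFine_smul, abs_mul]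
    exact mul_le_mul_of_nonneg_left (h.2.1 μ x hx hxe) (abs_nonneg c)
  · rw [Pi.smul_apply, smul_eq_mul, abs_mul, mul_assoc]
    exact mul_le_mul_of_nonneg_left (h.2.2 x hx) (abs_nonneg c)

/-- A FINE FIELD `δ` WITH `|δ| ≤ ε` on the fine sites of `S` and `|∂δ| ≤ ε` on its fine bonds is, paired with the unit
field `0`, in the class `𝒮(ε)` (`|Qδ| ≤ ε` by averaging; `ε ≤ εα⁻¹` for `0 < α ≤ 1`).
[cite: Dimock2013BalabanII, §3.11.2 Lemma 3.13 proof L4105–4109 (arXiv:1212.5562v2 TeX)] -/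
theorem of_fine_sup {ε : ℝ} {δ : X d → ℝ} (hα : 0 < α) (hα1 : α ≤ 1) (hS : S₀ ⊆ S)
    (hδ : ∀ x ∈ U n S, |δ x| ≤ ε)
    (hdδ : ∀ μ : Fin d, ∀ x ∈ U n S, x + e μ ∈ U n S → |fdFine n μ δ x| ≤ ε) :
    LocalSmallField n ε α S₀ S 0 δ := by
  refine ⟨fun y hy => ?_, hdδ, fun x hx => ?_⟩
  · rw [Pi.zero_apply, zero_sub, abs_neg]
    exact abs_qavg_le fun p hp => hδ p (mem_U.2 (by rw [mem_B.1 hp]; exact hS hy))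
  · have h1 := hδ x hx
    have hε : 0 ≤ ε := (abs_nonneg _).trans h1
    have hinv : 1 ≤ α⁻¹ := one_le_inv_iff₀.2 ⟨hα, hα1⟩
    calc |δ x| ≤ ε * 1 := by rw [mul_one]; exact h1
      _ ≤ ε * α⁻¹ := mul_le_mul_of_nonneg_left hinv hε

/-- **REPLACEMENT OF THE FINE FIELD**: if `(Φ, φ) ∈ 𝒮(q)` and `φ′ − φ` is `ε`-small together with its derivative on the
fine sites ∕ bonds of `S`, then `(Φ, φ′) ∈ 𝒮(q + ε)` — the mechanism of *"by (note7) we may replace φ⁰_{k+1,Ω(□)} by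
φ⁰_{k+1,Ω′}"* and of the (note6) step. [cite: Dimock2013BalabanII, §3.11.2 Lemma 3.13 proof L4105–4109, L4135–4137 (arXiv:1212.5562v2 TeX)] -/
theorem fine_replacement {ε : ℝ} {φ' : X d → ℝ} (hα : 0 < α) (hα1 : α ≤ 1) (hS : S₀ ⊆ S)
    (h : LocalSmallField n q α S₀ S Φ φ) (hδ : ∀ x ∈ U n S, |(φ' - φ) x| ≤ ε)
    (hdδ : ∀ μ : Fin d, ∀ x ∈ U n S, x + e μ ∈ U n S → |fdFine n μ (φ' - φ) x| ≤ ε) :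
    LocalSmallField n (q + ε) α S₀ S Φ φ' := by
  have h2 := sf_add h (of_fine_sup hα hα1 hS hδ hdδ)
  have e1 : Φ + 0 = Φ := add_zero Φ
  have e2 : φ + (φ' - φ) = φ' := by abel
  rwa [e1, e2] at h2

/-- **PERTURBATION OF THE UNIT FIELD UNDER A LINEAR BACKGROUND MAP**: if `(Ψ, bg Ψ) ∈ 𝒮(q)`, `|Ψ′ − Ψ| ≤ t` on `S₀`, the
background map is additive on this pair and `|bg(Ψ′ − Ψ)|, |∂ bg(Ψ′ − Ψ)| ≤ Kt` on the fine sites ∕ bonds of `S`, then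
`(Ψ′, bg Ψ′) ∈ 𝒮(q + (1 + K)t)` — the mechanism of *"But |Ψ^{loc} − Ψ| ≤ e^{−r_{k+1}} from (salt). Hence Ψ^{loc} ∈
½𝒮_k(□)"* (reading (ii): the regularity of `bg` is used tacitly there).
[cite: Dimock2013BalabanII, §3.11.2 Lemma 3.13 proof L4148–4150 (arXiv:1212.5562v2 TeX)] -/
theorem unit_perturbation {t K : ℝ} {bg : (X d → ℝ) → X d → ℝ} {Ψ Ψ' : X d → ℝ} (hα : 0 < α) (hα1 : α ≤ 1)
    (hS : S₀ ⊆ S) (hK : 0 ≤ K) (ht : 0 ≤ t) (h : LocalSmallField n q α S₀ S Ψ (bg Ψ))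
    (hadd : bg Ψ' = bg Ψ + bg (Ψ' - Ψ)) (hδ : ∀ y ∈ S₀, |(Ψ' - Ψ) y| ≤ t)
    (hbg : ∀ x ∈ U n S, |bg (Ψ' - Ψ) x| ≤ K * t)
    (hdbg : ∀ μ : Fin d, ∀ x ∈ U n S, x + e μ ∈ U n S → |fdFine n μ (bg (Ψ' - Ψ)) x| ≤ K * t) :
    LocalSmallField n (q + (1 + K) * t) α S₀ S Ψ' (bg Ψ') := by
  have hinv : 1 ≤ α⁻¹ := one_le_inv_iff₀.2 ⟨hα, hα1⟩
  have hKt : K * t ≤ (1 + K) * t := by nlinarith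
  have h1Kt : 0 ≤ (1 + K) * t := mul_nonneg (by linarith) ht
  -- the perturbation pair `(Ψ′ − Ψ, bg(Ψ′ − Ψ))` is in `𝒮((1+K)t)`
  have hpert : LocalSmallField n ((1 + K) * t) α S₀ S (Ψ' - Ψ) (bg (Ψ' - Ψ)) := by
    refine ⟨fun y hy => ?_, fun μ x hx hxe => (hdbg μ x hx hxe).trans hKt, fun x hx => ?_⟩
    · have h2 : |qavg n (bg (Ψ' - Ψ)) y| ≤ K * t :=
        abs_qavg_le fun p hp => hbg p (mem_U.2 (by rw [mem_B.1 hp]; exact hS hy))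
      calc |(Ψ' - Ψ) y - qavg n (bg (Ψ' - Ψ)) y| ≤ |(Ψ' - Ψ) y| + |qavg n (bg (Ψ' - Ψ)) y| := abs_sub _ _
        _ ≤ t + K * t := add_le_add (hδ y hy) h2
        _ = (1 + K) * t := by ring
    · calc |bg (Ψ' - Ψ) x| ≤ (1 + K) * t := (hbg x hx).trans hKt
        _ = (1 + K) * t * 1 := (mul_one _).symm
        _ ≤ (1 + K) * t * α⁻¹ := mul_le_mul_of_nonneg_left hinv h1Kt
  have h2 := sf_add h hpert
  have e1 : Ψ + (Ψ' - Ψ) = Ψ' := by abel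
  rwa [e1, ← hadd] at h2

end Classes

/-! ## Part 2. The fluctuation half: `(C^{1/2}_{k,Ω′})^{loc}W_k ∈ ½𝒮_k(□)` (L4080–4093) -/

section Fluctuation

variable {n : ℕ} {pk p0k α C₁ C₂ : ℝ} {S₀ S Sbig : Finset (X d)} {bg : (X d → ℝ) → X d → ℝ} {W : X d → ℝ}

/-- **THE FLUCTUATION HALF** (L4080–4093): from (summers) `|W̃| ≤ C₂p_{0,k}`, `|∂W̃| ≤ C₂p_{0,k}` on the unit points `Sbig`
(`W̃ = (C^{1/2}_{k,Ω′})^{loc}W_k`), LEMMA 3.1 (2.) in the hypothesis shape `converse` (*"if … |Φ_k| ≤ p_kα_k^{−1}, |∂Φ_k| ≤ p_k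
then Φ_k ∈ C𝒮_k(□)"*, homogeneous in the bound), `0 < α_k ≤ 1` and the smallness `C₁C₂p_{0,k} ≤ ½p_k` (*"Cp_{0,k}p_k^{−1} <
½"*): `(W̃, bg W̃) ∈ ½𝒮_k(□)`. [cite: Dimock2013BalabanII, §3.11.2 Lemma 3.13 proof L4080–4093 (arXiv:1212.5562v2 TeX)] -/
theorem fluctuation_half (hα : 0 < α) (hα1 : α ≤ 1) (hC₂ : 0 ≤ C₂) (hp0 : 0 ≤ p0k)
    (converse : ∀ q' : ℝ, ∀ Φ : X d → ℝ, (∀ y ∈ Sbig, |Φ y| ≤ q' * α⁻¹) →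
      (∀ μ : Fin d, ∀ y ∈ Sbig, y + e μ ∈ Sbig → |fdUnit μ Φ y| ≤ q') →
        LocalSmallField n (C₁ * q') α S₀ S Φ (bg Φ))
    (hW : ∀ y ∈ Sbig, |W y| ≤ C₂ * p0k)
    (hdW : ∀ μ : Fin d, ∀ y ∈ Sbig, y + e μ ∈ Sbig → |fdUnit μ W y| ≤ C₂ * p0k)
    (hsmall : C₁ * (C₂ * p0k) ≤ pk / 2) :
    LocalSmallField n (pk / 2) α S₀ S W (bg W) := by
  have hinv : 1 ≤ α⁻¹ := one_le_inv_iff₀.2 ⟨hα, hα1⟩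
  have hq0 : 0 ≤ C₂ * p0k := mul_nonneg hC₂ hp0
  have hW' : ∀ y ∈ Sbig, |W y| ≤ C₂ * p0k * α⁻¹ := fun y hy =>
    (hW y hy).trans (by nlinarith [mul_le_mul_of_nonneg_left hinv hq0])
  exact sf_mono hα.le (converse (C₂ * p0k) W hW' hdW) hsmall

/-- **«for p_0 < p and λ_k sufficiently small Cp_{0,k}p_k^{−1} = C(−log λ_k)^{p_0−p} < ½» MADE EXPLICIT**: with `ℓ = −log λ_k`,
`p_k = ℓ^p`, `p_{0,k} = ℓ^{p₀}`, `p₀ < p`, `C > 0`: if `ℓ ≥ (2C)^{1/(p−p₀)}` then `C·ℓ^{p₀} ≤ ½ℓ^p`.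
[cite: Dimock2013BalabanII, §3.11.2 Lemma 3.13 proof L4092–4093 (arXiv:1212.5562v2 TeX)] -/
theorem log_powers_half {C p p₀ ℓ : ℝ} (hC : 0 < C) (hp : p₀ < p) (hℓ : 0 < ℓ)
    (hbig : (2 * C) ^ (1 / (p - p₀)) ≤ ℓ) : C * ℓ ^ p₀ ≤ ℓ ^ p / 2 := by
  have hpp : 0 < p - p₀ := sub_pos.2 hp
  have h2C : 0 ≤ 2 * C := by linarith
  have h1 : 2 * C ≤ ℓ ^ (p - p₀) := by
    have h := Real.rpow_le_rpow (Real.rpow_nonneg h2C _) hbig hpp.le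
    rwa [← Real.rpow_mul h2C, one_div_mul_cancel hpp.ne', Real.rpow_one] at h
  have h2 : ℓ ^ p = ℓ ^ (p - p₀) * ℓ ^ p₀ := by
    rw [← Real.rpow_add hℓ, sub_add_cancel]
  rw [h2]
  have hp0 : 0 < ℓ ^ p₀ := Real.rpow_pos_of_pos hℓ _
  nlinarith

/-- The same as a statement about `p_{0,k}/p_k`: `C·p_{0,k} ≤ ½p_k`, the form consumed by `fluctuation_half` (`C = C₁C₂`).
[cite: Dimock2013BalabanII, §3.11.2 Lemma 3.13 proof L4088–4093 (arXiv:1212.5562v2 TeX)] -/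
theorem smallness_of_log_powers {C₁ C₂ p p₀ ℓ : ℝ} (hC₁ : 0 < C₁) (hC₂ : 0 < C₂) (hp : p₀ < p) (hℓ : 0 < ℓ)
    (hbig : (2 * (C₁ * C₂)) ^ (1 / (p - p₀)) ≤ ℓ) : C₁ * (C₂ * ℓ ^ p₀) ≤ ℓ ^ p / 2 := by
  rw [← mul_assoc]
  exact log_powers_half (mul_pos hC₁ hC₂) hp hℓ hbig

end Fluctuation

/-! ## Part 3. The background half: (not) → (not4) → (not5) → (snappy) → `¼𝒮_k(□)` → `½𝒮_k(□)` (L4105–4150) -/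

section Background

variable {n : ℕ} {q ε α : ℝ} {S₀ S : Finset (X d)} {Φ φ φ' : X d → ℝ}

/-- **(not) ⟹ (not4)** (L4105–4116): (not) = `(Φ_{k+1}, φ⁰_{k+1,Ω⁺(□)}) ∈ 𝒮(q)` with `q = p_{k+1}L^{−1/2}` (reading (i)) and the
(note7) bounds `|φ⁰_□ − φ⁰_{Ω′}|, |∂(φ⁰_□ − φ⁰_{Ω′})| ≤ ε` with *"M sufficiently large"* = `ε ≤ q` give `(Φ_{k+1}, φ⁰_{k+1,Ω′}) ∈
𝒮(2q)`: *"|Φ_{k+1} − Q_{k+1}φ⁰_{k+1,Ω′}| ≤ 2p_{k+1}L^{−1/2}, |∂φ⁰_{k+1,Ω′}| ≤ 2p_{k+1}L^{−3/2}, |φ⁰_{k+1,Ω′}| ≤ 2p_{k+1}α_{k+1}^{−1}L^{−1/2}"*.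
[cite: Dimock2013BalabanII, §3.11.2 Lemma 3.13 proof eq. (not4) L4105–4116 (arXiv:1212.5562v2 TeX)] -/
theorem not4 (hα : 0 < α) (hα1 : α ≤ 1) (hS : S₀ ⊆ S) (h : LocalSmallField n q α S₀ S Φ φ)
    (hδ : ∀ x ∈ U n S, |(φ' - φ) x| ≤ ε)
    (hdδ : ∀ μ : Fin d, ∀ x ∈ U n S, x + e μ ∈ U n S → |fdFine n μ (φ' - φ) x| ≤ ε) (hε : ε ≤ q) :
    LocalSmallField n (2 * q) α S₀ S Φ φ' :=
  sf_mono hα.le (fine_replacement hα hα1 hS h hδ hdδ) (by linarith)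

/-- **(ding3) AS A DEFINITION**: `Ψ_{k,Ω_{k+1}}(Ω′)(y) = (Q_kφ⁰)(y) + c·(Q^T(Φ_{k+1} − Q_{k+1}φ⁰))(y)` with `c = aL^{−2}/(a_k +
aL^{−2})` — on the two-level carrier: unit point `y`, its `L`-block `blk m y` (`L = m+1`), `n′+1` fine sites per unit side,
`n+1 = (m+1)(n′+1)` per `L`-block side (`Q_k = qavg n′`, `Q_{k+1} = qavg n`, `Q^T` = constant extension over the `L`-block).
[cite: Dimock2013BalabanII, §3.11.2 Lemma 3.13 proof eq. (ding3) L4119–4123 (arXiv:1212.5562v2 TeX)] -/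
def psiOf (m n' : ℕ) (c : ℝ) (Φ' φ₀ : X d → ℝ) : X d → ℝ := fun y =>
  qavg n' φ₀ y + c * (Φ' (blk m y) - qavg (m * n' + m + n') φ₀ (blk m y))

/-- `Ψ − Q_kφ⁰ = c·Q^T(Φ_{k+1} − Q_{k+1}φ⁰)` pointwise (*"This lets us replace Φ_{k+1} − Q_{k+1}φ⁰_{k+1,Ω′} by Ψ_{k,Ω_{k+1}}(Ω′) −
Q_kφ⁰_{k+1,Ω′} in the above inequality"*). [cite: Dimock2013BalabanII, §3.11.2 Lemma 3.13 proof L4119–4125 (arXiv:1212.5562v2 TeX)] -/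
theorem psiOf_sub_qavg (m n' : ℕ) (c : ℝ) (Φ' φ₀ : X d → ℝ) (y : X d) :
    psiOf m n' c Φ' φ₀ y - qavg n' φ₀ y = c * (Φ' (blk m y) - qavg (m * n' + m + n') φ₀ (blk m y)) := by
  simp only [psiOf]
  ring

/-- THE TWO-LEVEL SITE SETS: the fine sites of the `L`-blocks `T` are the fine sites of the unit cubes of `T`
(`BlockAveragingComposition.blk_blk`). [cite: Dimock2013BalabanII, §2.1 L465–467 (arXiv:1212.5562v2 TeX)] -/
theorem U_comp (m n' : ℕ) (T : Finset (X d)) : U (m * n' + m + n') T = U n' (U m T) := by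
  ext p
  simp only [mem_U, blk_blk]

/-- THE TWO NORMALISATIONS OF `∂`: in `L`-block units the fine derivative is `(m+1)` times the fine derivative in unit
units (`(n+1) = (m+1)(n′+1)`). [cite: Dimock2013BalabanII, §3.10 eq. (not) L3610–3617 with L3619–3622 (arXiv:1212.5562v2 TeX)] -/
theorem fdFine_two_level (m n' : ℕ) (μ : Fin d) (f : X d → ℝ) (x : X d) :
    fdFine (m * n' + m + n') μ f x = ((m : ℝ) + 1) * fdFine n' μ f x := by
  simp only [fdFine]
  push_cast
  ring

/-- **(not4) ⟹ (not5)** (L4119–4134): if `(Φ_{k+1}, φ⁰) ∈ 𝒮_{L-blocks}(q)` on the block labels `T₀ ⊆ T` (fine side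
`n+1 = (m+1)(n′+1)`), then for `0 ≤ c ≤ 1` the pair `(Ψ, φ⁰)` with `Ψ = psiOf m n′ c Φ_{k+1} φ⁰` is in `𝒮_{units}(q)` on the
unit points of those blocks (fine side `n′+1`): clause 1 by `psiOf_sub_qavg` (`c ≤ 1`), clause 2 by `fdFine_two_level`
(the printed `2p_{k+1}L^{−3/2}`, here weakened to `≤ q`, reading (i)), clause 3 unchanged.
[cite: Dimock2013BalabanII, §3.11.2 Lemma 3.13 proof eq. (not5) L4119–4134 (arXiv:1212.5562v2 TeX)] -/
theorem not5 {m n' : ℕ} {c : ℝ} {T₀ T : Finset (X d)} {Φ' φ₀ : X d → ℝ} (hc0 : 0 ≤ c) (hc1 : c ≤ 1)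
    (h : LocalSmallField (m * n' + m + n') q α T₀ T Φ' φ₀) :
    LocalSmallField n' q α (U m T₀) (U m T) (psiOf m n' c Φ' φ₀) φ₀ := by
  refine ⟨fun y hy => ?_, fun μ x hx hxe => ?_, fun x hx => ?_⟩
  · have hu : blk m y ∈ T₀ := mem_U.1 hy
    have hb := h.1 _ hu
    rw [psiOf_sub_qavg, abs_mul, abs_of_nonneg hc0]
    calc c * |Φ' (blk m y) - qavg (m * n' + m + n') φ₀ (blk m y)| ≤ 1 * q :=
        mul_le_mul hc1 hb (abs_nonneg _) zero_le_one
      _ = q := one_mul q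
  · have hx' : x ∈ U (m * n' + m + n') T := by rw [U_comp]; exact hx
    have hxe' : x + e μ ∈ U (m * n' + m + n') T := by rw [U_comp]; exact hxe
    have hb := h.2.1 μ x hx' hxe'
    have hq : 0 ≤ q := (abs_nonneg _).trans hb
    rw [fdFine_two_level, abs_mul, abs_of_pos (by positivity : (0 : ℝ) < (m : ℝ) + 1)] at hb
    have hm : (0 : ℝ) ≤ (m : ℝ) := Nat.cast_nonneg m
    nlinarith [abs_nonneg (fdFine n' μ φ₀ x)]
  · have hx' : x ∈ U (m * n' + m + n') T := by rw [U_comp]; exact hx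
    exact h.2.2 x hx'

/-- **(not5) ⟹ (snappy)** (L4135–4144): the (note6) replacement `φ_{k,Ω(Λ*_k)}(Ψ̂) ↦ φ^{min}_{k,Ω(□)}` with bounds `≤ ε′ ≤ q`
(*"for M sufficiently large"*) takes `𝒮(2q)` to `𝒮(3q)`: *"|Ψ − Q_kφ^{min}| ≤ 3p_{k+1}L^{−1/2}, |∂φ^{min}| ≤ 3p_{k+1}L^{−3/2},
|φ^{min}| ≤ 3p_{k+1}α_{k+1}^{−1}L^{−1/2}"*. [cite: Dimock2013BalabanII, §3.11.2 Lemma 3.13 proof eq. (snappy) L4135–4144 (arXiv:1212.5562v2 TeX)] -/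
theorem snappy {Ψ φ₀ φmin : X d → ℝ} (hα : 0 < α) (hα1 : α ≤ 1) (hS : S₀ ⊆ S)
    (h : LocalSmallField n (2 * q) α S₀ S Ψ φ₀) (hδ : ∀ x ∈ U n S, |(φmin - φ₀) x| ≤ ε)
    (hdδ : ∀ μ : Fin d, ∀ x ∈ U n S, x + e μ ∈ U n S → |fdFine n μ (φmin - φ₀) x| ≤ ε) (hε : ε ≤ q) :
    LocalSmallField n (3 * q) α S₀ S Ψ φmin :=
  sf_mono hα.le (fine_replacement hα hα1 hS h hδ hdδ) (by linarith)

/-- **«Since α_{k+1}^{−1} ≤ L^{−1/4}α_k^{−1}»** (L4144) for `α = ConstantFieldSplit.alpha` (`α_k = max{μ̄_k^{1/2}, λ_k^{1/4}}`), the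
flow `λ_{k+1} = Lλ_k`, `μ̄_{k+1} = L²μ̄_k` and `L ≥ 1`: `α(L²μ̄, Lλ) ≥ L^{1/4}α(μ̄, λ)`, stated on the inverses.
[cite: Dimock2013BalabanII, §3.11.2 Lemma 3.13 proof L4144 with §3.2 L2056–2058 (arXiv:1212.5562v2 TeX)] -/
theorem inv_alpha_succ_le {μ lam L : ℝ} (hμ : 0 ≤ μ) (hlam : 0 < lam) (hL : 1 ≤ L) :
    (alpha (L ^ 2 * μ) (L * lam))⁻¹ ≤ L ^ (-(1 / 4 : ℝ)) * (alpha μ lam)⁻¹ := by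
  have hL0 : 0 < L := by linarith
  have hα : 0 < alpha μ lam := alpha_pos hlam
  have hq : 0 < L ^ (1 / 4 : ℝ) := Real.rpow_pos_of_pos hL0 _
  -- `L^{1/4}·α(μ̄, λ) ≤ α(L²μ̄, Lλ)`
  have hkey : L ^ (1 / 4 : ℝ) * alpha μ lam ≤ alpha (L ^ 2 * μ) (L * lam) := by
    unfold alpha
    rw [mul_max_of_nonneg _ _ hq.le]
    refine max_le_max ?_ ?_
    · rw [Real.sqrt_mul' _ hμ, Real.sqrt_sq hL0.le]
      refine mul_le_mul_of_nonneg_right ?_ (Real.sqrt_nonneg μ)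
      calc L ^ (1 / 4 : ℝ) ≤ L ^ (1 : ℝ) := Real.rpow_le_rpow_of_exponent_le hL (by norm_num)
        _ = L := Real.rpow_one L
    · rw [Real.mul_rpow hL0.le hlam.le]
  rw [Real.rpow_neg hL0.le, ← mul_inv, inv_le_inv₀ (alpha_pos (mul_pos hL0 hlam)) (mul_pos hq hα)]
  exact hkey

/-- **THE `¼` ARITHMETIC** (L4144–4147: *"Since α_{k+1}^{−1} ≤ L^{−1/4}α_k^{−1} and p_{k+1} ≤ (1 + log L)^p p_k this says that Ψ
∈ ¼𝒮_k(□) for L sufficiently large"*), abstract form: `p_{k+1} ≤ G·p_k`, `α_{k+1}^{−1} ≤ τ·α_k^{−1}` with `0 ≤ τ ≤ 1`, and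
*"L sufficiently large"* = `12·G·s ≤ 1` (`s = L^{−1/2}`, `G = (1 + log L)^p`, `τ = L^{−1/4}`) give `3p_{k+1}s ≤ ¼p_k` and
`3p_{k+1}s·α_{k+1}^{−1} ≤ ¼p_k·α_k^{−1}`. [cite: Dimock2013BalabanII, §3.11.2 Lemma 3.13 proof L4144–4147 (arXiv:1212.5562v2 TeX)] -/
theorem quarter_arith {pk pk1 ak ak1 G s τ : ℝ} (hpk : 0 ≤ pk) (hpk1 : 0 ≤ pk1) (hak : 0 < ak) (hs : 0 ≤ s)
    (hτ0 : 0 ≤ τ) (hτ1 : τ ≤ 1) (hp : pk1 ≤ G * pk) (hα : ak1⁻¹ ≤ τ * ak⁻¹) (hbig : 12 * G * s ≤ 1) :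
    3 * (pk1 * s) ≤ pk / 4 ∧ 3 * (pk1 * s) * ak1⁻¹ ≤ pk / 4 * ak⁻¹ := by
  have hi : 0 < ak⁻¹ := inv_pos.2 hak
  have h0 : pk1 * s ≤ G * pk * s := mul_le_mul_of_nonneg_right hp hs
  have hb : pk * (12 * G * s) ≤ pk * 1 := mul_le_mul_of_nonneg_left hbig hpk
  have h1 : 3 * (pk1 * s) ≤ pk / 4 := by nlinarith
  refine ⟨h1, ?_⟩
  have hpos : 0 ≤ 3 * (pk1 * s) := by positivity
  calc 3 * (pk1 * s) * ak1⁻¹ ≤ 3 * (pk1 * s) * (τ * ak⁻¹) := mul_le_mul_of_nonneg_left hα hpos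
    _ ≤ pk / 4 * (τ * ak⁻¹) := mul_le_mul_of_nonneg_right h1 (mul_nonneg hτ0 hi.le)
    _ ≤ pk / 4 * ak⁻¹ := by nlinarith [mul_le_mul_of_nonneg_left hτ1 (mul_nonneg (by linarith : (0:ℝ) ≤ pk / 4) hi.le)]

/-- The `¼` arithmetic WITH THE PRINTED QUANTITIES: `s = L^{−1/2}`, `τ = L^{−1/4}`, `G = (1 + log L)^p` and *"L sufficiently
large"* = `12(1 + log L)^p ≤ L^{1/2}`. [cite: Dimock2013BalabanII, §3.11.2 Lemma 3.13 proof L4144–4147 (arXiv:1212.5562v2 TeX)] -/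
theorem quarter_arith_L {pk pk1 ak ak1 L P : ℝ} (hpk : 0 ≤ pk) (hpk1 : 0 ≤ pk1) (hak : 0 < ak) (hL : 1 ≤ L)
    (hp : pk1 ≤ (1 + Real.log L) ^ P * pk) (hα : ak1⁻¹ ≤ L ^ (-(1 / 4 : ℝ)) * ak⁻¹)
    (hbig : 12 * (1 + Real.log L) ^ P ≤ L ^ (1 / 2 : ℝ)) :
    3 * (pk1 * L ^ (-(1 / 2 : ℝ))) ≤ pk / 4 ∧
      3 * (pk1 * L ^ (-(1 / 2 : ℝ))) * ak1⁻¹ ≤ pk / 4 * ak⁻¹ := by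
  have hL0 : 0 < L := by linarith
  have hs : 0 < L ^ (-(1 / 2 : ℝ)) := Real.rpow_pos_of_pos hL0 _
  have hτ0 : 0 ≤ L ^ (-(1 / 4 : ℝ)) := (Real.rpow_pos_of_pos hL0 _).le
  have hτ1 : L ^ (-(1 / 4 : ℝ)) ≤ 1 := Real.rpow_le_one_of_one_le_of_nonpos hL (by norm_num)
  have hss : L ^ (1 / 2 : ℝ) * L ^ (-(1 / 2 : ℝ)) = 1 := by
    rw [← Real.rpow_add hL0]; norm_num
  have hbig' : 12 * (1 + Real.log L) ^ P * L ^ (-(1 / 2 : ℝ)) ≤ 1 := by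
    calc 12 * (1 + Real.log L) ^ P * L ^ (-(1 / 2 : ℝ)) ≤ L ^ (1 / 2 : ℝ) * L ^ (-(1 / 2 : ℝ)) :=
        mul_le_mul_of_nonneg_right hbig hs.le
      _ = 1 := hss
  exact quarter_arith hpk hpk1 hak hs.le hτ0 hτ1 hp hα hbig'

/-- *"L sufficiently large"* is inhabited: at `L = e^{10}` and `p = 1`, `12(1 + log L)^p = 132 ≤ e^5 = L^{1/2}` (the
condition is monotone in neither variable, so only an instance is recorded; for every `p` such `L` exist).
[cite: Dimock2013BalabanII, §3.11.2 Lemma 3.13 proof L4146–4147 (arXiv:1212.5562v2 TeX)] -/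
theorem quarter_condition_inhabited :
    12 * (1 + Real.log (Real.exp 10)) ^ (1 : ℝ) ≤ (Real.exp 10) ^ (1 / 2 : ℝ) := by
  rw [Real.log_exp, Real.rpow_one, ← Real.exp_mul]
  have h5 : Real.exp (10 * (1 / 2 : ℝ)) = Real.exp 1 ^ 5 := by
    rw [Real.exp_one_pow]; norm_num
  rw [h5]
  have h := Real.exp_one_gt_d9
  have hpow : (2.7182818283 : ℝ) ^ 5 ≤ Real.exp 1 ^ 5 := pow_le_pow_left₀ (by norm_num) h.le 5
  have hnum : (132 : ℝ) ≤ (2.7182818283 : ℝ) ^ 5 := by norm_num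
  linarith

/-- **(snappy) ⟹ `Ψ_{k,Ω_{k+1}}(Ω′) ∈ ¼𝒮_k(□)`** (L4144–4147): the class `𝒮(3q)` at level-`(k+1)` parameters (`q = p_{k+1}s`,
`α_{k+1}`) lies in `¼𝒮_k(□)` (`¼p_k`, `α_k`) under the two inequalities of `quarter_arith`.
[cite: Dimock2013BalabanII, §3.11.2 Lemma 3.13 proof L4144–4147 (arXiv:1212.5562v2 TeX)] -/
theorem quarter {pk pk1 ak ak1 s : ℝ} {Ψ φmin : X d → ℝ}
    (h : LocalSmallField n (3 * (pk1 * s)) ak1 S₀ S Ψ φmin)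
    (h1 : 3 * (pk1 * s) ≤ pk / 4) (h2 : 3 * (pk1 * s) * ak1⁻¹ ≤ pk / 4 * ak⁻¹) :
    LocalSmallField n (pk / 4) ak S₀ S Ψ φmin :=
  sf_mono₂ h h1 h2

/-- **`Ψ ∈ ¼𝒮_k(□)` ∧ `|Ψ^{loc} − Ψ| ≤ e^{−r_{k+1}}` ⟹ `Ψ^{loc} ∈ ½𝒮_k(□)`** (L4148–4150), with the background map's regularity
(`|bg δ|, |∂ bg δ| ≤ K·e^{−r_{k+1}}`) and the smallness `(1 + K)e^{−r_{k+1}} ≤ ¼p_k` explicit (reading (ii)).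
[cite: Dimock2013BalabanII, §3.11.2 Lemma 3.13 proof L4148–4150 (arXiv:1212.5562v2 TeX)] -/
theorem half_of_quarter {pk t K : ℝ} {bg : (X d → ℝ) → X d → ℝ} {Ψ Ψloc : X d → ℝ} (hα : 0 < α) (hα1 : α ≤ 1)
    (hS : S₀ ⊆ S) (hK : 0 ≤ K) (ht : 0 ≤ t) (h : LocalSmallField n (pk / 4) α S₀ S Ψ (bg Ψ))
    (hadd : bg Ψloc = bg Ψ + bg (Ψloc - Ψ)) (hδ : ∀ y ∈ S₀, |(Ψloc - Ψ) y| ≤ t)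
    (hbg : ∀ x ∈ U n S, |bg (Ψloc - Ψ) x| ≤ K * t)
    (hdbg : ∀ μ : Fin d, ∀ x ∈ U n S, x + e μ ∈ U n S → |fdFine n μ (bg (Ψloc - Ψ)) x| ≤ K * t)
    (hsmall : (1 + K) * t ≤ pk / 4) :
    LocalSmallField n (pk / 2) α S₀ S Ψloc (bg Ψloc) :=
  sf_mono hα.le (unit_perturbation hα hα1 hS hK ht h hadd hδ hbg hdbg) (by linarith)

/-- **LEMMA 3.13, FIRST CONCLUSION `χ_k(Λ**_{k+1}) = 1`** (L4074–4078): *"we must show that Ψ^{loc} + (C^{1/2}_{k,Ω′})^{loc}W_k ∈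
𝒮_k(□) … We argue separately that (C^{1/2}_{k,Ω′})^{loc}W_k ∈ ½𝒮_k(□) and that Ψ^{loc} ∈ ½𝒮_k(□)"* — the two halves and the
additivity of the background map give the pair `(Ψ^{loc} + W̃, bg(Ψ^{loc} + W̃))` in `𝒮_k(□)` (bound `p_k`), i.e. the
characteristic function `χ_k(□)` of DEFINITION 3.s equals `1` at this field.
[cite: Dimock2013BalabanII, §3.11.2 Lemma 3.13 (vanishing) L4065–4078 (arXiv:1212.5562v2 TeX)] -/
theorem chi_eq_one {pk : ℝ} {bg : (X d → ℝ) → X d → ℝ} {Ψloc W : X d → ℝ}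
    (hΨ : LocalSmallField n (pk / 2) α S₀ S Ψloc (bg Ψloc)) (hW : LocalSmallField n (pk / 2) α S₀ S W (bg W))
    (hadd : bg (Ψloc + W) = bg Ψloc + bg W) :
    LocalSmallField n pk α S₀ S (Ψloc + W) (bg (Ψloc + W)) := by
  have h := sf_add hΨ hW
  rwa [add_halves, ← hadd] at h

end Background

/-! ## Part 4. The `χ^q` half: `χ^q_k(Λ**_{k+1}) = 1` via (ding2) (L4155–4163) -/

section ChiQ

variable {m n' : ℕ}

/-- The block average of a function constant on `L`-blocks is that constant. [cite: Dimock2013BalabanII, §3.7 eq. (ding2) with §2.1 L465–467 (arXiv:1212.5562v2 TeX)] -/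
theorem qavg_blockConst {m : ℕ} {g G : X d → ℝ} (hg : ∀ y, g y = G (blk m y)) (u : X d) : qavg m g u = G u := by
  rw [qavg_def]
  have hsum : ∑ p ∈ B m u, g p = ∑ _p ∈ B m u, G u :=
    Finset.sum_congr rfl fun p hp => by rw [hg, mem_B.1 hp]
  rw [hsum, sum_B_const, ← mul_assoc, inv_mul_cancel₀ (by positivity), one_mul]

/-- **`QΨ` COMPUTED FROM (ding3)**: `(QΨ)(u) = (Q_{k+1}φ⁰)(u) + c·(Φ_{k+1} − Q_{k+1}φ⁰)(u)` (`Q ∘ Q_k = Q_{k+1}` by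
`qavg_comp`, and `Q` of the block-constant second term). [cite: Dimock2013BalabanII, §3.7 eqs. (ding2)∕(ding3), §3.11.2 L4119–4123, L4160–4163 (arXiv:1212.5562v2 TeX)] -/
theorem qavg_psiOf (c : ℝ) (Φ' φ₀ : X d → ℝ) (u : X d) :
    qavg m (psiOf m n' c Φ' φ₀) u =
      qavg (m * n' + m + n') φ₀ u + c * (Φ' u - qavg (m * n' + m + n') φ₀ u) := by
  have hsplit : psiOf m n' c Φ' φ₀ =
      qavg n' φ₀ + fun y => c * (Φ' (blk m y) - qavg (m * n' + m + n') φ₀ (blk m y)) := by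
    funext y; simp only [psiOf, Pi.add_apply]
  rw [hsplit, qavg_add, qavg_comp]
  congr 1
  exact qavg_blockConst (G := fun v => c * (Φ' v - qavg (m * n' + m + n') φ₀ v)) (fun _ => rfl) u

/-- **(ding2) FROM (ding3)**: `Φ_{k+1} − QΨ_{k,Ω_{k+1}}(Ω′) = (1 − c)(Φ_{k+1} − Q_{k+1}φ⁰_{k+1,Ω′})` with `1 − c = a_k/(a_k + aL^{−2})`
(`sub_coeff`) — *"This follows by (ding2) and then (not4): |Φ_{k+1} − QΨ| ≤ |Φ_{k+1} − Q_{k+1}φ⁰_{k+1,Ω′}|"*.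
[cite: Dimock2013BalabanII, §3.11.2 Lemma 3.13 proof L4160–4163 with §3.7 eq. (ding2) (arXiv:1212.5562v2 TeX)] -/
theorem ding2 (c : ℝ) (Φ' φ₀ : X d → ℝ) (u : X d) :
    Φ' u - qavg m (psiOf m n' c Φ' φ₀) u = (1 - c) * (Φ' u - qavg (m * n' + m + n') φ₀ u) := by
  rw [qavg_psiOf]
  ring

/-- the coefficient: `1 − aL^{−2}/(a_k + aL^{−2}) = a_k/(a_k + aL^{−2})` (`a_k + aL^{−2} ≠ 0`).
[cite: Dimock2013BalabanII, §3.7 eqs. (ding2)∕(ding3) (arXiv:1212.5562v2 TeX)] -/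
theorem sub_coeff {ak aL : ℝ} (h : ak + aL ≠ 0) : 1 - aL / (ak + aL) = ak / (ak + aL) := by
  rw [eq_div_iff h, sub_mul, div_mul_cancel₀ _ h, one_mul]
  ring

/-- **`|Φ_{k+1} − QΨ| ≤ ½p_k`** (L4160–4163): from (not4)'s first clause `|Φ_{k+1} − Q_{k+1}φ⁰_{Ω′}| ≤ 2q` on the block labels
`T₀`, `0 ≤ c ≤ 1`, and `2q ≤ ½p_k` (`q = p_{k+1}L^{−1/2}`; *"2p_{k+1}L^{−1/2} ≤ ½p_k"*).
[cite: Dimock2013BalabanII, §3.11.2 Lemma 3.13 proof L4160–4163 (arXiv:1212.5562v2 TeX)] -/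
theorem chi_q_half {q pk α c : ℝ} {T₀ T : Finset (X d)} {Φ' φ₀ : X d → ℝ} (hc0 : 0 ≤ c) (hc1 : c ≤ 1)
    (h : LocalSmallField (m * n' + m + n') (2 * q) α T₀ T Φ' φ₀) (hq : 2 * q ≤ pk / 2) {u : X d} (hu : u ∈ T₀) :
    |Φ' u - qavg m (psiOf m n' c Φ' φ₀) u| ≤ pk / 2 := by
  have hb := h.1 u hu
  rw [ding2, abs_mul, abs_of_nonneg (by linarith : (0 : ℝ) ≤ 1 - c)]
  calc (1 - c) * |Φ' u - qavg (m * n' + m + n') φ₀ u| ≤ 1 * (2 * q) :=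
      mul_le_mul (by linarith) hb (abs_nonneg _) zero_le_one
    _ ≤ pk / 2 := by linarith

/-- **LEMMA 3.13, SECOND CONCLUSION `χ^q_k(Λ**_{k+1}) = 1`** (L4155–4163): `|Φ_{k+1} − Q(Ψ^{loc} + W̃)| ≤ p_k` at the block `u`
from `|Φ_{k+1} − QΨ| ≤ ½p_k`, (salt) `|Ψ^{loc} − Ψ| ≤ t` and (summers) `|W̃| ≤ w` on the unit points of the block, and `t + w
≤ ½p_k` (*"By (salt) and (summers) this reduces to showing that |Φ_{k+1} − QΨ| ≤ ½p_k"*).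
[cite: Dimock2013BalabanII, §3.11.2 Lemma 3.13 (vanishing) proof L4155–4163 (arXiv:1212.5562v2 TeX)] -/
theorem chi_q_eq_one {pk t w : ℝ} {Φ' Ψ Ψloc W : X d → ℝ} {u : X d}
    (hΨ : |Φ' u - qavg m Ψ u| ≤ pk / 2) (hloc : ∀ y ∈ B m u, |Ψloc y - Ψ y| ≤ t)
    (hW : ∀ y ∈ B m u, |W y| ≤ w) (hsmall : t + w ≤ pk / 2) :
    |Φ' u - qavg m (Ψloc + W) u| ≤ pk := by
  have e1 : Ψloc + W = Ψ + ((Ψloc - Ψ) + W) := by abel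
  have h2 : |qavg m ((Ψloc - Ψ) + W) u| ≤ t + w := by
    rw [qavg_add]
    refine (abs_add_le _ _).trans (add_le_add ?_ ?_)
    · exact abs_qavg_le fun p hp => by rw [Pi.sub_apply]; exact hloc p hp
    · exact abs_qavg_le hW
  have e2 : Φ' u - (qavg m Ψ u + qavg m ((Ψloc - Ψ) + W) u) =
      (Φ' u - qavg m Ψ u) - qavg m ((Ψloc - Ψ) + W) u := by ring
  rw [e1, qavg_add, e2]
  calc |(Φ' u - qavg m Ψ u) - qavg m ((Ψloc - Ψ) + W) u|
      ≤ |Φ' u - qavg m Ψ u| + |qavg m ((Ψloc - Ψ) + W) u| := abs_sub _ _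
    _ ≤ pk / 2 + (t + w) := add_le_add hΨ h2
    _ ≤ pk := by linarith

end ChiQ

/-! ## Part 5. LEMMA 3.11: the bracketed characteristic functions do not depend on `W_k` in `Λ_{k+1}` (L3942–3958) -/

section Support

open Literature.MathematicalPhysics.QuantumFieldTheory.Dimock2011to13.CharacteristicFunctionSplit (enl subset_enl)

variable {C : Type*} [Fintype C] [DecidableEq C] {dC : C → C → ℕ} {r : ℕ}

omit [DecidableEq C] in
/-- `X ↦ X*` is monotone. [cite: Dimock2013BalabanII, §3.1.4 (buffers) L1791–1800 (arXiv:1212.5562v2 TeX)] -/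
theorem enl_mono {X Y : Finset C} (h : X ⊆ Y) : enl dC r X ⊆ enl dC r Y := by
  intro x hx
  simp only [enl, Finset.mem_filter, Finset.mem_univ, true_and] at hx ⊢
  obtain ⟨y, hy, hd⟩ := hx
  exact ⟨y, h hy, hd⟩

/-- **`((X*)^c)* ⊆ X^c`** for a symmetric distance (the set algebra of *"on W_k in ((Λ**_{k+1})^c)* ⊂ (Λ*_{k+1})^c"*, with `X
= Λ*_{k+1}`): a site within `r` of a site NOT within `r` of `X` is not in `X`.
[cite: Dimock2013BalabanII, §3.11.2 Lemma 3.11 proof L3953–3955 (arXiv:1212.5562v2 TeX)] -/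
theorem enl_compl_enl_subset (hsymm : ∀ x y, dC x y = dC y x) (X : Finset C) :
    enl dC r (enl dC r X)ᶜ ⊆ Xᶜ := by
  intro x hx
  simp only [enl, Finset.mem_filter, Finset.mem_univ, true_and] at hx
  obtain ⟨y, hy, hd⟩ := hx
  rw [Finset.mem_compl] at hy ⊢
  intro hxX
  exact hy (Finset.mem_filter.2 ⟨Finset.mem_univ _, x, hxX, by rw [hsymm]; exact hd⟩)

/-- `((Λ**)^c)* ⊆ Λ^c` (*"((Λ**_{k+1})^c)* ⊂ (Λ*_{k+1})^c ⊂ Λ^c_{k+1}"*; `Λ ⊆ Λ*` needs `d(x,x) = 0`).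
[cite: Dimock2013BalabanII, §3.11.2 Lemma 3.11 proof L3953–3955 (arXiv:1212.5562v2 TeX)] -/
theorem enl_compl_enl_enl_subset (hd0 : ∀ x, dC x x = 0) (hsymm : ∀ x y, dC x y = dC y x) (Λ : Finset C) :
    enl dC r (enl dC r (enl dC r Λ))ᶜ ⊆ Λᶜ :=
  (enl_compl_enl_subset hsymm (enl dC r Λ)).trans (compl_subset_compl.2 (subset_enl hd0 r Λ))

/-- `((Λ**)^c)** ⊆ Λ^c` (*"By a similar argument this depends on W_k on ((Λ**_{k+1})^c)** ⊂ Λ^c_{k+1}"*).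
[cite: Dimock2013BalabanII, §3.11.2 Lemma 3.11 proof L3956–3958 (arXiv:1212.5562v2 TeX)] -/
theorem enl_enl_compl_subset (hsymm : ∀ x y, dC x y = dC y x) (Λ : Finset C) :
    enl dC r (enl dC r (enl dC r (enl dC r Λ))ᶜ) ⊆ Λᶜ :=
  (enl_mono (enl_compl_enl_subset hsymm (enl dC r Λ))).trans (enl_compl_enl_subset hsymm Λ)

variable {β : Type*}

omit [DecidableEq C] in
/-- LOCALITY OF AN OPERATOR THROUGH `*`: *"(C^{1/2}_{k,Ω′})^{loc}f on a set X only depends on f in X*"* — `T f` on `A` is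
determined by `f` on `A*`. [cite: Dimock2013BalabanII, §3.11.2 Lemma 3.11 proof L3949–3952 (arXiv:1212.5562v2 TeX)] -/
def LocalThrough (dC : C → C → ℕ) (r : ℕ) (T : (C → ℝ) → C → ℝ) : Prop :=
  ∀ A : Finset C, ∀ f g : C → ℝ, (∀ i ∈ enl dC r A, f i = g i) → ∀ i ∈ A, T f i = T g i

omit [DecidableEq C] in
/-- A functional of `(T f)|_A` with `T` local through `*` depends on `f` only in `A*`.
[cite: Dimock2013BalabanII, §3.11.2 Lemma 3.11 proof L3949–3955 (arXiv:1212.5562v2 TeX)] -/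
theorem dependsOn_comp_local {T : (C → ℝ) → C → ℝ} (hT : LocalThrough dC r T) {G : (C → ℝ) → β} {A : Finset C}
    (hG : DependsOn G (A : Set C)) : DependsOn (fun f => G (T f)) ((enl dC r A : Finset C) : Set C) := by
  intro f g hfg
  exact hG fun i hi => hT A f g (fun j hj => hfg j (Finset.mem_coe.2 hj)) i (Finset.mem_coe.1 hi)

/-- **LEMMA 3.11 FOR `χ^q_k(Ω_{k+1} − Λ**_{k+1})`** (L3953–3955): a functional of `(T W)` on `(Λ**)^c` (`T = (C^{1/2}_{k,Ω′})^{loc}`,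
local through `*`) depends on `W` only in `((Λ**)^c)* ⊆ Λ^c` — *"does not depend on W_k in Λ_{k+1}"*.
[cite: Dimock2013BalabanII, §3.11.2 Lemma 3.11 L3942–3955 (arXiv:1212.5562v2 TeX)] -/
theorem lemma311_q (hd0 : ∀ x, dC x x = 0) (hsymm : ∀ x y, dC x y = dC y x) {T : (C → ℝ) → C → ℝ}
    (hT : LocalThrough dC r T) {G : (C → ℝ) → β} (Λ : Finset C)
    (hG : DependsOn G (((enl dC r (enl dC r Λ))ᶜ : Finset C) : Set C)) :
    DependsOn (fun W => G (T W)) ((Λᶜ : Finset C) : Set C) :=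
  (dependsOn_comp_local hT hG).mono (Finset.coe_subset.2 (enl_compl_enl_enl_subset hd0 hsymm Λ))

/-- **LEMMA 3.11 FOR `χ_k(Λ_k − Λ**_{k+1})`** (L3955–3958): a functional of `T₂(T₁ W)` on `(Λ**)^c` with both operators local
through `*` (`T₁ = (C^{1/2}_{k,Ω′})^{loc}`, `T₂ = φ_{k,Ω(□)}(·)` on `□̃`) depends on `W` only in `((Λ**)^c)** ⊆ Λ^c`.
[cite: Dimock2013BalabanII, §3.11.2 Lemma 3.11 L3942–3958 (arXiv:1212.5562v2 TeX)] -/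
theorem lemma311_chi (hsymm : ∀ x y, dC x y = dC y x) {T₁ T₂ : (C → ℝ) → C → ℝ} (hT₁ : LocalThrough dC r T₁)
    (hT₂ : LocalThrough dC r T₂) {G : (C → ℝ) → β} (Λ : Finset C)
    (hG : DependsOn G (((enl dC r (enl dC r Λ))ᶜ : Finset C) : Set C)) :
    DependsOn (fun W => G (T₂ (T₁ W))) ((Λᶜ : Finset C) : Set C) :=
  (dependsOn_comp_local hT₁ (dependsOn_comp_local hT₂ hG)).mono
    (Finset.coe_subset.2 (enl_enl_compl_subset hsymm Λ))

end Support

/-! ## Non-vacuity -/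

/-- The class algebra is not vacuous: the zero pair is in every class `𝒮(q)`, `q ≥ 0`, `α > 0` (so `add`∕`mono`∕`smul`
have instances; `sf_add`∕`sf_mono`∕`sf_smul`). [cite: Dimock2013BalabanII, §3.2 Definition 3.s (yass1) L2063–2073 (arXiv:1212.5562v2 TeX)] -/
theorem zero_mem {n : ℕ} {q α : ℝ} (hq : 0 ≤ q) (hα : 0 < α) (S₀ S : Finset (X d)) :
    LocalSmallField n q α S₀ S 0 0 := by
  refine ⟨fun y hy => ?_, fun μ x hx hxe => ?_, fun x hx => ?_⟩
  · simp [qavg_def, hq]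
  · simp [fdFine, hq]
  · simp only [Pi.zero_apply, abs_zero]; exact mul_nonneg hq (inv_nonneg.2 hα.le)

/-- The (ding3) field of a zero background is the block-constant pull-back `c·Φ_{k+1}` (sanity check of `psiOf`).
[cite: Dimock2013BalabanII, §3.11.2 eq. (ding3) L4119–4123 (arXiv:1212.5562v2 TeX)] -/
example (m n' : ℕ) (c : ℝ) (Φ' : X 1 → ℝ) (y : X 1) : psiOf m n' c Φ' 0 y = c * Φ' (blk m y) := by
  simp [psiOf, qavg_def]

end Literature.MathematicalPhysics.QuantumFieldTheory.Dimock2011to13.RedundantCharacteristicFunctions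

end
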